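import Summits.QuantumFields.BalabanUV.Beta.GAN24.OneStepConstraintAxialDelKRate
import Summits.QuantumFields.BalabanUV.Beta.GAN24.StepCovarianceTwoClauses

/-!
# `BalabanUV.Beta.GAN24.OneStepConstraintAxialDelKLimit` — binder row G-an2-4 ∕ (CONV-C), routes C-R6° («VALUES») × R7 («TWO CURRENCIES») × pv09's B6 torus line, PART 184:
# THE GAUGE-FIXED ONE-LOOP LETTER `𝒢_n = flucCov(re Δ_n, Q_ax)` IN (CONV-C)'s TWO-CLAUSE SHAPE, ALONG THE TOWER, AND ITS NAMED `n → ∞` LIMIT WITH TAIL — every coarse torus, NO residual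
# hypothesis: (i) `|𝒢_n(x,x′)| ≤ C·e^{−κD}` and (ii) `|(𝒢_{n′} − 𝒢_n)(x,x′)| ≤ C·n⁻²·e^{−κD}` with ONE pair `(κ, C)` (PART 181 ∕ 183 joined); along `n_k = Lb^k` the literal shape with
# `θ = Lb⁻²`; and the FULL-SEQUENCE limit `𝒢_∞(x,x′)` with tail `C·(n+1)⁻²·e^{−κD}` and localisation `|𝒢_∞(x,x′)| ≤ C·e^{−κD}` (leaf-06's `StepCovarianceTwoClauses` pattern for pv09's
# box-currency object, here for an2's `flucCov` in the lineage's block-distance currency) — census V201 (η)  (unit b2b-balaban-gan24-p3, gen 60; v1)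

NOT IN PRINT; OUR PROOF ([folklore] bookkeeping BY NAME over PART 181 `OneStepConstraintAxialDelK.exists_flucCov_DelK_axial_decay`, PART 183 `OneStepConstraintAxialDelKRate.exists_flucCov_DelK_axial_rate`,
leaf-06's `StepCovarianceTwoClauses.one_le_pow_of_neZero`, `B9FromB6.decay_mono`, Mathlib's `cauchySeq_of_le_tendsto_0'` ∕ `cauchySeq_tendsto_of_complete` ∕ `le_of_tendsto`.
[King1986] Lemma 4.5 (4.38)–(4.41) p. 674 is the printed SHAPE (`|C^{(k)} − C^{(k+n)}| ≤ CL^{−k}e^{−δ₀|x−y|}`, the limit by a geometric ∕ `n⁻²` Cauchy argument); [Balaban1984PropagatorsII]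
(2.156) p. 250 LOCATES the object; nothing printed is a hypothesis.)
HONEST FRAMING (cell contract, verbatim): «discharging `BetaPertH` makes Bałaban's UV stability UNCONDITIONAL — a real constructive-QFT result; it is NOT the continuum limit
and NOT the Clay problem.»  HONEST DEPENDENCY (verbatim): «continuum YM on T⁴ ⇐ BetaPertH ∧ nine spine estimates (0/9 proved); BetaPertH ⇐ (D1) ∧ (D4) ∧ CAP+tail; G-an2-4 gates
asym, D1 and NE2/3/4.»

WHAT THIS FILE PROVES (0 sorry, 0 `def`; dimension `d + 1 ≥ 2`, blocking factor `Lb ≥ 1`, dummies `a, a′ > 0`; `Q_ax = fromRows (re QB 1 Lb M′) E_tree` spelled inline):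
* **`flucCov_DelK_axial_two_levels`** — `∃ κ C > 0` (functions of `d, Lb, a′`) such that for EVERY coarse torus `M′`, ALL `1 ≤ n ≤ n′` and all bonds: (i) `|𝒢_n(x,x′)| ≤ C·e^{−κ·tdist(par x, par x′)}`,
  (ii) `|(𝒢_{n′} − 𝒢_n)(x,x′)| ≤ C·(n²)⁻¹·e^{−κ·tdist(par x, par x′)}`.
* **`flucCov_DelK_axial_two_clauses`** — along the tower `n_k = Lb^k`: the literal two-clause shape with `θ = (Lb²)⁻¹` (`(Lb^k)⁻² = θ^k`).
* **`tendsto_flucCov_DelK_axial_full`** — the FULL-SEQUENCE limit: `∃ κ C > 0 ∀ M′ ∃ 𝒢_∞ : Matrix …`, `𝒢_{n+1}(x,x′) → 𝒢_∞(x,x′)` with tail `C·(n+1)⁻²·e^{−κD}` and `|𝒢_∞(x,x′)| ≤ C·e^{−κD}` — the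
  limit is NAMED on the fixed finite carrier `Tor (fine (Lb·1) M′) × Fin (d+1)` (n-independent), not identified with any continuum object.
WHAT IT IS NOT: EL₂ (the volume limit `M′ ↗`) and the loop contraction (census V201 (ε)(ζ)) are untouched; `U = 1`, first-order MODEL framing; NOT an instance of the ℤ^{d+1} predicate
`ConvC`.  SUPPLIER work; NEVER «G-an2-4 closed»; NOT (CONV-C), NOT D1, NOT `BetaPertH`, NOT continuum, NOT Clay.  Records: `HOME/b2b-balaban-gan24-p3/gen60/README.md`.
-/

noncomputable section

open scoped BigOperators Matrix ComplexOrder Topology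
open Finset Matrix Filter

namespace Summit.QuantumFields.BalabanUV.Beta.GAN24.OneStepConstraintAxialDelKLimit

open Literature.MathematicalPhysics.QuantumFieldTheory.Balaban1983to89
open Literature.MathematicalPhysics.QuantumFieldTheory.Balaban1983to89.Beta.CompositionSingular (flucCov)
open Literature.MathematicalPhysics.QuantumFieldTheory.Balaban1983to89.B5Prop11Plancherel (Tor fine)
open Literature.MathematicalPhysics.QuantumFieldTheory.Balaban1983to89.B5RealFields (reM)
open Literature.MathematicalPhysics.QuantumFieldTheory.Balaban1983to89.Beta.VectorTailsCov (tdist)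
open Literature.MathematicalPhysics.QuantumFieldTheory.Balaban1983to89.Beta.BlockEffectiveAction (DelK)
open Summit.QuantumFields.BalabanUV.T4Continuum.BalabanLineAverage (QB)
open Summit.QuantumFields.BalabanUV.T4Continuum.BalabanAveragedTowerModes (par rem)
open Summit.QuantumFields.BalabanUV.Beta.GAN24.OneStepConstraintAxialDelK (exists_flucCov_DelK_axial_decay)
open Summit.QuantumFields.BalabanUV.Beta.GAN24.OneStepConstraintAxialDelKRate (exists_flucCov_DelK_axial_rate)
open Summit.QuantumFields.BalabanUV.Beta.GAN24.StepCovarianceTwoClauses (one_le_pow_of_neZero)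

variable {d : ℕ} (Lb : ℕ) [NeZero Lb] (a : ℝ) (ha : 0 < a)

/-- **`flucCov_DelK_axial_two_levels` — BOTH CLAUSES FOR THE GAUGE-FIXED ONE-LOOP LETTER, ONE PAIR `(κ, C)`**: in dimension `d + 1 ≥ 2`, for all `a, a′ > 0` there are `κ, C > 0`
(functions of `d, Lb, a′`) such that for EVERY coarse torus `M′`, ALL levels `1 ≤ n ≤ n′` and all unit bonds `x, x′`: (i) `|𝒢_n(x,x′)| ≤ C·e^{−κ·tdist(par x, par x′)}`,
(ii) `|(𝒢_{n′} − 𝒢_n)(x,x′)| ≤ C·(n²)⁻¹·e^{−κ·tdist(par x, par x′)}` — PARTs 181 and 183 at the smaller rate and the larger constant. [folklore] -/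
theorem flucCov_DelK_axial_two_levels (hd : 1 ≤ d) {a' : ℝ} (ha' : 0 < a') :
    ∃ κ C : ℝ, 0 < κ ∧ 0 < C ∧ ∀ (M₁ : Fin (d + 1) → ℕ) [∀ μ, NeZero (M₁ μ)] (n n' : ℕ) [NeZero n] [NeZero n'] (hn : 1 ≤ n) (hn' : 1 ≤ n'), n ≤ n' →
      ∀ x x' : Tor (fine (Lb * 1) M₁) × Fin (d + 1),
      |flucCov (reM (DelK n hn (fine (Lb * 1) M₁) a ha)) (Matrix.fromRows (reM (QB 1 Lb M₁)) (fun (t : {x : Tor (fine (Lb * 1) M₁) × Fin (d + 1) // (∀ ν, ν < x.2 → ((rem 1 Lb M₁ x.1 ν : ℕ)) = 0) ∧ ((rem 1 Lb M₁ x.1 x.2 : ℕ)) + 1 < Lb}) (x : Tor (fine (Lb * 1) M₁) × Fin (d + 1)) => if x = (Function.Embedding.subtype (fun x : Tor (fine (Lb * 1) M₁) × Fin (d + 1) => (∀ ν, ν < x.2 → ((rem 1 Lb M₁ x.1 ν : ℕ)) = 0) ∧ ((rem 1 Lb M₁ x.1 x.2 : ℕ)) + 1 < Lb)) t then (1 :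 ℝ) else 0)) x x'| ≤ C * Real.exp (-(κ * (tdist (par 1 Lb M₁ x.1) (par 1 Lb M₁ x'.1) : ℝ))) ∧
      |(flucCov (reM (DelK n' hn' (fine (Lb * 1) M₁) a ha)) (Matrix.fromRows (reM (QB 1 Lb M₁)) (fun (t : {x : Tor (fine (Lb * 1) M₁) × Fin (d + 1) // (∀ ν, ν < x.2 → ((rem 1 Lb M₁ x.1 ν : ℕ)) = 0) ∧ ((rem 1 Lb M₁ x.1 x.2 : ℕ)) + 1 < Lb}) (x : Tor (fine (Lb * 1) M₁) × Fin (d + 1)) => if x = (Function.Embedding.subtype (fun x : Tor (fine (Lb * 1) M₁) × Fin (d + 1) => (∀ ν, ν < x.2 → ((rem 1 Lb M₁ x.1 ν : ℕ)) = 0) ∧ ((rem 1 Lb M₁ x.1 x.2 : ℕ)) + 1 < Lb)) t then (1 : ℝ) else 0)) - flucCov (reM (DelK n hn (fine (Lb * 1) M₁) a ha)) (Matrix.fromRows (reM (QB 1 Lb M₁)) (fun (t : {x : Tor (fine (Lb * 1) M₁) × Fin (d + 1) // (∀ ν, ν < x.2 → ((rem 1 Lb M₁ x.1 ν : ℕ))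 = 0) ∧ ((rem 1 Lb M₁ x.1 x.2 : ℕ)) + 1 < Lb}) (x : Tor (fine (Lb * 1) M₁) × Fin (d + 1)) => if x = (Function.Embedding.subtype (fun x : Tor (fine (Lb * 1) M₁) × Fin (d + 1) => (∀ ν, ν < x.2 → ((rem 1 Lb M₁ x.1 ν : ℕ)) = 0) ∧ ((rem 1 Lb M₁ x.1 x.2 : ℕ)) + 1 < Lb)) t then (1 : ℝ) else 0))) x x'| ≤ C * ((n : ℝ) ^ 2)⁻¹ * Real.exp (-(κ * (tdist (par 1 Lb M₁ x.1) (par 1 Lb M₁ x'.1) : ℝ))) := by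
  obtain ⟨C₁, m₁, hm₁, H₁⟩ := exists_flucCov_DelK_axial_decay Lb a ha hd ha'
  obtain ⟨C₂, m₂, hm₂, H₂⟩ := exists_flucCov_DelK_axial_rate Lb a ha hd ha'
  refine ⟨min m₁ m₂, max (max C₁ C₂) 1, lt_min hm₁ hm₂, lt_of_lt_of_le one_pos (le_max_right _ _), fun M₁ _ n n' _ _ hn hn' hnn' x x' => ?_⟩
  have hD : (0 : ℝ) ≤ (tdist (par 1 Lb M₁ x.1) (par 1 Lb M₁ x'.1) : ℝ) := Nat.cast_nonneg _
  have hC0 : (0 : ℝ) ≤ max (max C₁ C₂) 1 := le_trans zero_le_one (le_max_right _ _)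
  have e₁ : Real.exp (-(m₁ * (tdist (par 1 Lb M₁ x.1) (par 1 Lb M₁ x'.1) : ℝ))) ≤ Real.exp (-(min m₁ m₂ * (tdist (par 1 Lb M₁ x.1) (par 1 Lb M₁ x'.1) : ℝ))) := B9FromB6.decay_mono (min_le_left _ _) hD
  have e₂ : Real.exp (-(m₂ * (tdist (par 1 Lb M₁ x.1) (par 1 Lb M₁ x'.1) : ℝ))) ≤ Real.exp (-(min m₁ m₂ * (tdist (par 1 Lb M₁ x.1) (par 1 Lb M₁ x'.1) : ℝ))) := B9FromB6.decay_mono (min_le_right _ _) hD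
  constructor
  · refine (H₁ M₁ n hn x x').trans ?_
    calc C₁ * Real.exp (-(m₁ * (tdist (par 1 Lb M₁ x.1) (par 1 Lb M₁ x'.1) : ℝ))) ≤ max (max C₁ C₂) 1 * Real.exp (-(m₁ * (tdist (par 1 Lb M₁ x.1) (par 1 Lb M₁ x'.1) : ℝ))) :=
          mul_le_mul_of_nonneg_right ((le_max_left _ _).trans (le_max_left _ _)) (Real.exp_pos _).le
      _ ≤ max (max C₁ C₂) 1 * Real.exp (-(min m₁ m₂ * (tdist (par 1 Lb M₁ x.1) (par 1 Lb M₁ x'.1) : ℝ))) := mul_le_mul_of_nonneg_left e₁ hC0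
  · refine (H₂ M₁ n n' hn hn' hnn' x x').trans ?_
    have hn2 : (0 : ℝ) ≤ ((n : ℝ) ^ 2)⁻¹ := by positivity
    calc C₂ * ((n : ℝ) ^ 2)⁻¹ * Real.exp (-(m₂ * (tdist (par 1 Lb M₁ x.1) (par 1 Lb M₁ x'.1) : ℝ))) ≤ max (max C₁ C₂) 1 * ((n : ℝ) ^ 2)⁻¹ * Real.exp (-(m₂ * (tdist (par 1 Lb M₁ x.1) (par 1 Lb M₁ x'.1) : ℝ))) :=
          mul_le_mul_of_nonneg_right (mul_le_mul_of_nonneg_right ((le_max_right _ _).trans (le_max_left _ _)) hn2) (Real.exp_pos _).le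
      _ ≤ max (max C₁ C₂) 1 * ((n : ℝ) ^ 2)⁻¹ * Real.exp (-(min m₁ m₂ * (tdist (par 1 Lb M₁ x.1) (par 1 Lb M₁ x'.1) : ℝ))) := mul_le_mul_of_nonneg_left e₂ (by positivity)

/-- **`flucCov_DelK_axial_two_clauses` — ALONG THE TOWER `n_k = Lb^k`: THE LITERAL TWO-CLAUSE SHAPE WITH `θ = (Lb²)⁻¹`** (`(Lb^k)⁻² = θ^k`): for every coarse torus and every `k`,
`|𝒢_{Lb^k}(x,x′)| ≤ C·e^{−κD}` and `|(𝒢_{Lb^{k+1}} − 𝒢_{Lb^k})(x,x′)| ≤ C·θ^k·e^{−κD}` — King's (4.38) shape for the gauge-fixed one-loop letter of the first-order model at U = 1.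
[cite: King1986, Lemma 4.5 (4.38) p.674 (shape)] [folklore] -/
theorem flucCov_DelK_axial_two_clauses (hd : 1 ≤ d) {a' : ℝ} (ha' : 0 < a') :
    ∃ κ C : ℝ, 0 < κ ∧ 0 < C ∧ ∀ (M₁ : Fin (d + 1) → ℕ) [∀ μ, NeZero (M₁ μ)] (k : ℕ) (x x' : Tor (fine (Lb * 1) M₁) × Fin (d + 1)),
      |flucCov (reM (DelK (Lb ^ k) (one_le_pow_of_neZero Lb k) (fine (Lb * 1) M₁) a ha)) (Matrix.fromRows (reM (QB 1 Lb M₁)) (fun (t : {x : Tor (fine (Lb * 1) M₁) × Fin (d + 1) // (∀ ν, ν < x.2 → ((rem 1 Lb M₁ x.1 ν : ℕ)) = 0) ∧ ((rem 1 Lb M₁ x.1 x.2 : ℕ)) + 1 < Lb}) (x : Tor (fine (Lb * 1) M₁) × Fin (d + 1)) => if x = (Function.Embedding.subtype (fun x : Tor (fine (Lb * 1) M₁) × Fin (d + 1) => (∀ ν, ν < x.2 → ((rem 1 Lb M₁ x.1 ν : ℕ)) = 0) ∧ ((rem 1 Lb M₁ x.1 x.2 : ℕ)) + 1 < Lb))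 t then (1 : ℝ) else 0)) x x'| ≤ C * Real.exp (-(κ * (tdist (par 1 Lb M₁ x.1) (par 1 Lb M₁ x'.1) : ℝ))) ∧
      |(flucCov (reM (DelK (Lb ^ (k + 1)) (one_le_pow_of_neZero Lb (k + 1)) (fine (Lb * 1) M₁) a ha)) (Matrix.fromRows (reM (QB 1 Lb M₁)) (fun (t : {x : Tor (fine (Lb * 1) M₁) × Fin (d + 1) // (∀ ν, ν < x.2 → ((rem 1 Lb M₁ x.1 ν : ℕ)) = 0) ∧ ((rem 1 Lb M₁ x.1 x.2 : ℕ)) + 1 < Lb}) (x : Tor (fine (Lb * 1) M₁) × Fin (d + 1)) => if x = (Function.Embedding.subtype (fun x : Tor (fine (Lb * 1) M₁) × Fin (d + 1) => (∀ ν, ν < x.2 → ((rem 1 Lb M₁ x.1 ν : ℕ)) = 0) ∧ ((rem 1 Lb M₁ x.1 x.2 : ℕ)) + 1 < Lb)) t then (1 : ℝ) else 0))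
        - flucCov (reM (DelK (Lb ^ k) (one_le_pow_of_neZero Lb k) (fine (Lb * 1) M₁) a ha)) (Matrix.fromRows (reM (QB 1 Lb M₁)) (fun (t : {x : Tor (fine (Lb * 1) M₁) × Fin (d + 1) // (∀ ν, ν < x.2 → ((rem 1 Lb M₁ x.1 ν : ℕ)) = 0) ∧ ((rem 1 Lb M₁ x.1 x.2 : ℕ)) + 1 < Lb}) (x : Tor (fine (Lb * 1) M₁) × Fin (d + 1)) => if x = (Function.Embedding.subtype (fun x : Tor (fine (Lb * 1) M₁) × Fin (d + 1) => (∀ ν, ν < x.2 → ((rem 1 Lb M₁ x.1 ν : ℕ)) = 0) ∧ ((rem 1 Lb M₁ x.1 x.2 : ℕ)) + 1 < Lb)) t then (1 : ℝ) else 0))) x x'| ≤ C * (((Lb : ℝ) ^ 2)⁻¹) ^ k * Real.exp (-(κ * (tdist (par 1 Lb M₁ x.1) (par 1 Lb M₁ x'.1) : ℝ))) := by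
  obtain ⟨κ, C, hκ, hC, H⟩ := flucCov_DelK_axial_two_levels Lb a ha hd ha'
  refine ⟨κ, C, hκ, hC, fun M₁ _ k x x' => ?_⟩
  have h := H M₁ (Lb ^ k) (Lb ^ (k + 1)) (one_le_pow_of_neZero Lb k) (one_le_pow_of_neZero Lb (k + 1))
    (Nat.pow_le_pow_right (Nat.pos_of_ne_zero (NeZero.ne Lb)) (Nat.le_succ k)) x x'
  have e : (((Lb ^ k : ℕ) : ℝ) ^ 2)⁻¹ = (((Lb : ℝ) ^ 2)⁻¹) ^ k := by
    rw [Nat.cast_pow, ← pow_mul, ← inv_pow, pow_mul', inv_pow]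
  rw [e] at h
  exact h

/-- **`tendsto_flucCov_DelK_axial_full` — THE FULL-SEQUENCE `n → ∞` LIMIT OF THE GAUGE-FIXED ONE-LOOP LETTER, WITH TAIL AND LOCALISATION**: `∃ κ C > 0` such that on EVERY coarse
torus there is a kernel `𝒢_∞` on the fixed carrier with `𝒢_{n+1}(x,x′) → 𝒢_∞(x,x′)`, `|𝒢_{n+1}(x,x′) − 𝒢_∞(x,x′)| ≤ C·(n+1)⁻²·e^{−κD}` and `|𝒢_∞(x,x′)| ≤ C·e^{−κD}` (the full sequence is
Cauchy with modulus `n⁻²`; every tower is a subsequence). [cite: King1986, Lemma 4.5 (4.41) p.674 (pattern)] [folklore] -/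
theorem tendsto_flucCov_DelK_axial_full (hd : 1 ≤ d) {a' : ℝ} (ha' : 0 < a') :
    ∃ κ C : ℝ, 0 < κ ∧ 0 < C ∧ ∀ (M₁ : Fin (d + 1) → ℕ) [∀ μ, NeZero (M₁ μ)],
      ∃ Ginf : Matrix (Tor (fine (Lb * 1) M₁) × Fin (d + 1)) (Tor (fine (Lb * 1) M₁) × Fin (d + 1)) ℝ, ∀ x x' : Tor (fine (Lb * 1) M₁) × Fin (d + 1),
        Tendsto (fun n : ℕ => flucCov (reM (DelK (n + 1) (Nat.succ_pos n) (fine (Lb * 1) M₁) a ha)) (Matrix.fromRows (reM (QB 1 Lb M₁)) (fun (t : {x : Tor (fine (Lb * 1) M₁) × Fin (d + 1) // (∀ ν, ν < x.2 → ((rem 1 Lb M₁ x.1 ν : ℕ)) = 0) ∧ ((rem 1 Lb M₁ x.1 x.2 : ℕ)) + 1 < Lb}) (x : Tor (fine (Lb * 1) M₁) × Fin (d + 1)) => if x = (Function.Embedding.subtype (fun x : Tor (fine (Lb * 1) M₁) × Fin (d + 1) => (∀ ν, ν < x.2 → ((rem 1 Lb M₁ x.1 ν : ℕ)) = 0) ∧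 ((rem 1 Lb M₁ x.1 x.2 : ℕ)) + 1 < Lb)) t then (1 : ℝ) else 0)) x x') atTop (𝓝 (Ginf x x')) ∧
        (∀ n : ℕ, |flucCov (reM (DelK (n + 1) (Nat.succ_pos n) (fine (Lb * 1) M₁) a ha)) (Matrix.fromRows (reM (QB 1 Lb M₁)) (fun (t : {x : Tor (fine (Lb * 1) M₁) × Fin (d + 1) // (∀ ν, ν < x.2 → ((rem 1 Lb M₁ x.1 ν : ℕ)) = 0) ∧ ((rem 1 Lb M₁ x.1 x.2 : ℕ)) + 1 < Lb}) (x : Tor (fine (Lb * 1) M₁) × Fin (d + 1)) => if x = (Function.Embedding.subtype (fun x : Tor (fine (Lb * 1) M₁) × Fin (d + 1) => (∀ ν, ν < x.2 → ((rem 1 Lb M₁ x.1 ν : ℕ)) = 0) ∧ ((rem 1 Lb M₁ x.1 x.2 : ℕ)) + 1 < Lb)) t then (1 : ℝ) else 0)) x x' - Ginf x x'| ≤ C * (((n : ℝ) + 1) ^ 2)⁻¹ * Real.exp (-(κ * (tdist (par 1 Lb M₁ x.1) (par 1 Lb M₁ x'.1) : ℝ)))) ∧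
        |Ginf x x'| ≤ C * Real.exp (-(κ * (tdist (par 1 Lb M₁ x.1) (par 1 Lb M₁ x'.1) : ℝ))) := by
  obtain ⟨κ, C₀, hκ, hC₀, H⟩ := flucCov_DelK_axial_two_levels Lb a ha hd ha'
  refine ⟨κ, 2 * C₀, hκ, by positivity, fun M₁ _ => ?_⟩
  have key : ∀ x x' : Tor (fine (Lb * 1) M₁) × Fin (d + 1), ∃ g : ℝ,
      Tendsto (fun n : ℕ => flucCov (reM (DelK (n + 1) (Nat.succ_pos n) (fine (Lb * 1) M₁) a ha)) (Matrix.fromRows (reM (QB 1 Lb M₁)) (fun (t : {x : Tor (fine (Lb * 1) M₁) × Fin (d + 1) // (∀ ν, ν < x.2 → ((rem 1 Lb M₁ x.1 ν : ℕ)) = 0) ∧ ((rem 1 Lb M₁ x.1 x.2 : ℕ)) + 1 < Lb}) (x : Tor (fine (Lb * 1) M₁) × Fin (d + 1)) => if x = (Function.Embedding.subtype (fun x : Tor (fine (Lb * 1) M₁) × Fin (d + 1) => (∀ ν, ν < x.2 → ((rem 1 Lb M₁ x.1 ν : ℕ)) = 0) ∧ ((rem 1 Lb M₁ x.1 x.2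 : ℕ)) + 1 < Lb)) t then (1 : ℝ) else 0)) x x') atTop (𝓝 g) ∧
      (∀ n : ℕ, |flucCov (reM (DelK (n + 1) (Nat.succ_pos n) (fine (Lb * 1) M₁) a ha)) (Matrix.fromRows (reM (QB 1 Lb M₁)) (fun (t : {x : Tor (fine (Lb * 1) M₁) × Fin (d + 1) // (∀ ν, ν < x.2 → ((rem 1 Lb M₁ x.1 ν : ℕ)) = 0) ∧ ((rem 1 Lb M₁ x.1 x.2 : ℕ)) + 1 < Lb}) (x : Tor (fine (Lb * 1) M₁) × Fin (d + 1)) => if x = (Function.Embedding.subtype (fun x : Tor (fine (Lb * 1) M₁) × Fin (d + 1) => (∀ ν, ν < x.2 → ((rem 1 Lb M₁ x.1 ν : ℕ)) = 0) ∧ ((rem 1 Lb M₁ x.1 x.2 : ℕ)) + 1 < Lb)) t then (1 : ℝ) else 0)) x x' - g| ≤ 2 * C₀ * (((n : ℝ) + 1) ^ 2)⁻¹ * Real.exp (-(κ * (tdist (par 1 Lb M₁ x.1) (par 1 Lb M₁ x'.1) : ℝ)))) ∧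
      |g| ≤ 2 * C₀ * Real.exp (-(κ * (tdist (par 1 Lb M₁ x.1) (par 1 Lb M₁ x'.1) : ℝ))) := by
    intro x x'
    set w : ℝ := Real.exp (-(κ * (tdist (par 1 Lb M₁ x.1) (par 1 Lb M₁ x'.1) : ℝ))) with hw
    have hw0 : 0 < w := Real.exp_pos _
    set F : ℕ → ℝ := fun n => flucCov (reM (DelK (n + 1) (Nat.succ_pos n) (fine (Lb * 1) M₁) a ha)) (Matrix.fromRows (reM (QB 1 Lb M₁)) (fun (t : {x : Tor (fine (Lb * 1) M₁) × Fin (d + 1) // (∀ ν, ν < x.2 → ((rem 1 Lb M₁ x.1 ν : ℕ)) = 0) ∧ ((rem 1 Lb M₁ x.1 x.2 : ℕ)) + 1 < Lb}) (x : Tor (fine (Lb * 1) M₁) × Fin (d + 1)) => if x = (Function.Embedding.subtype (fun x : Tor (fine (Lb * 1) M₁) × Fin (d + 1) => (∀ ν, ν < x.2 → ((rem 1 Lb M₁ x.1 ν : ℕ)) = 0) ∧ ((rem 1 Lb M₁ x.1 x.2 : ℕ)) + 1 < Lb)) t then (1 : ℝ) else 0)) x x' with hF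
    set b : ℕ → ℝ := fun n => C₀ * (((n : ℝ) + 1) ^ 2)⁻¹ * w with hb
    -- the Cauchy modulus from clause (ii) for any two levels `n + 1 ≤ m + 1`
    have hdist : ∀ n m : ℕ, n ≤ m → dist (F n) (F m) ≤ b n := by
      intro n m hnm
      rw [dist_comm, Real.dist_eq]
      have h := (H M₁ (n + 1) (m + 1) (Nat.succ_pos n) (Nat.succ_pos m) (by omega) x x').2
      have e : (((n + 1 : ℕ) : ℝ) ^ 2)⁻¹ = (((n : ℝ) + 1) ^ 2)⁻¹ := by push_cast; ring
      rw [Matrix.sub_apply, e] at h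
      exact h
    have hb0 : Tendsto b atTop (𝓝 0) := by
      have h1 : Tendsto (fun n : ℕ => (1 / ((n : ℝ) + 1)) ^ 2) atTop (𝓝 ((0 : ℝ) ^ 2)) :=
        (tendsto_one_div_add_atTop_nhds_zero_nat).pow 2
      rw [zero_pow two_ne_zero] at h1
      have h2 : Tendsto (fun n : ℕ => C₀ * (1 / ((n : ℝ) + 1)) ^ 2 * w) atTop (𝓝 (C₀ * 0 * w)) :=
        (tendsto_const_nhds.mul h1).mul tendsto_const_nhds
      rw [mul_zero, zero_mul] at h2
      refine h2.congr' (Filter.Eventually.of_forall fun n => ?_)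
      rw [hb]; simp only [one_div, inv_pow]
    obtain ⟨g, hlim⟩ := cauchySeq_tendsto_of_complete (cauchySeq_of_le_tendsto_0' b hdist hb0)
    have htail : ∀ n : ℕ, |F n - g| ≤ b n := by
      intro n
      rw [← Real.dist_eq]
      exact le_of_tendsto (tendsto_const_nhds.dist hlim) (Filter.eventually_atTop.2 ⟨n, fun m hm => hdist n m hm⟩)
    have hb1 : ∀ n : ℕ, b n ≤ 2 * C₀ * (((n : ℝ) + 1) ^ 2)⁻¹ * w := fun n => by
      rw [hb]; have : 0 ≤ C₀ * (((n : ℝ) + 1) ^ 2)⁻¹ * w := by positivity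
      nlinarith
    have h0 : |F 0| ≤ C₀ * w := (H M₁ 1 1 (Nat.succ_pos 0) (Nat.succ_pos 0) le_rfl x x').1
    refine ⟨g, hlim, fun n => (htail n).trans (hb1 n), ?_⟩
    have ht0 := htail 0
    have e0 : b 0 = C₀ * w := by rw [hb]; norm_num
    rw [e0] at ht0
    have h3 : g = F 0 - (F 0 - g) := by ring
    calc |g| = |F 0 - (F 0 - g)| := by rw [← h3]
      _ ≤ |F 0| + |F 0 - g| := abs_sub _ _
      _ ≤ C₀ * w + C₀ * w := add_le_add h0 ht0
      _ = 2 * C₀ * w := by ring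
  choose ginf hg using key
  exact ⟨Matrix.of fun x x' => ginf x x', fun x x' => hg x x'⟩

end Summit.QuantumFields.BalabanUV.Beta.GAN24.OneStepConstraintAxialDelKLimit

end
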